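import Summits.MatrixMultiplication.OmegaCensus.STPPSmallPatternKernelSearch122R
import Summits.MatrixMultiplication.OmegaCensus.STPPSmallPatternKernelProduct

/-!
# ω-census, `(1,2,2)^4` is infeasible in `ℤ/32` — pruned kernel search, part 29

HONEST FRAMING (pub-omega census; verbatim): lottery ticket; floor = certified bounds/negative ranges.
Census STRUCTURE bookkeeping of the STPP track (seat pub-omega-stpp-3, gen 25; STRUCTURE row B5, the threshold column
`T2(H) = max {k : (1,2,2)^k ⊆ H}`, lower side), not progress on `ω`: small patterns in small groups bound no exponent.

Chunks of `STPP122Neg.search2r (zcode 32) 4` (`decide +kernel`, ≈ 277 s predicted): entries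
`(y, c'₀, xb, xb2, XB, XC, PP)` = fixed start, exclusion masks on the codes of `b₁`, `b'₁`, and the forbidden
difference masks of the start's pair-class rank (`STPPSmallPatternKernelReflect122R.lean`); assembled in `STPPSmallPatternNone122K4Z32.lean`.

References: H. Cohn, R. Kleinberg, B. Szegedy, C. Umans, FOCS 2005 (arXiv:math/0511460), Def. 5.1.
-/

set_option Elab.async false
set_option synthInstance.maxSize 8192
set_option synthInstance.maxHeartbeats 800000

namespace Summit.MatrixMultiplication.OmegaCensus

namespace STPP122Neg

open STPP211Neg

/-- Pruned kernel search (min-flag normal form), `ℤ/32`, `k = 4`, start `(y, c'₀) = (1, 30)`: b₁ ∈ [4, 5, 6, 7, 8, 9]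
(≈ 111 s predicted). -/
theorem Z32k4r.x76 : search2r (zcode 32) 4
    [(1, 30, 536869888, 0, 0, 0, 44932727326565439797169045641969186908362552885715319882970099685582387906332218689950264912046218175872187064558110742044291086914181018106820417130340560925818262855957133837175313722000989442790891436115081898346054298439184685055074814732328631143305035629938177484960444052289939644798704605412531896320)] = true := by
  decide +kernel

/-- Pruned kernel search (min-flag normal form), `ℤ/32`, `k = 4`, start `(y, c'₀) = (1, 30)`: b₁ ∈ [10, 11, 12, 13, 14, 15, 16, 17, 18, 19, 20, 21, 22, 23, 24, 25, 26, 27, 28]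
(≈ 73 s predicted). -/
theorem Z32k4r.x77 : search2r (zcode 32) 4
    [(1, 30, 3758097407, 0, 0, 0, 44932727326565439797169045641969186908362552885715319882970099685582387906332218689950264912046218175872187064558110742044291086914181018106820417130340560925818262855957133837175313722000989442790891436115081898346054298439184685055074814732328631143305035629938177484960444052289939644798704605412531896320)] = true := by
  decide +kernel

/-- Pruned kernel search (min-flag normal form), `ℤ/32`, `k = 4`, start `(y, c'₀) = (8, 2)`: whole start
(≈ 94 s predicted). -/
theorem Z32k4r.x78 : search2r (zcode 32) 4
    [(8, 2, 0, 0, 0, 0, 89875055886476056539253254397454089116932154733405679271932101264170663639910003551025300363918687358645576102079586509239992485935686843117028543144417634229117934900230238465766706937022706608282193831880892038152517770669642665444168739844798346697058182528550046101888108918286430334576846696735035097088)] = true := by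
  decide +kernel

end STPP122Neg

end Summit.MatrixMultiplication.OmegaCensus
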